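import Literature.AnabelianGeometry.EtaleTheta.Discharge.Sec5Def54bAtSettingPinZN
import Literature.AnabelianGeometry.EtaleTheta.Discharge.Sec1ZNThetaImageInfDeltaThetaModels
import Literature.AnabelianGeometry.EtaleTheta.SettingModelChiThetaTopology
import Literature.AnabelianGeometry.EtaleTheta.SettingModelTateThetaTopology
import Literature.AnabelianGeometry.EtaleTheta.SettingModelChiCyclotomes
import Literature.AnabelianGeometry.EtaleTheta.SettingModelTateCyclotomes
import Literature.AnabelianGeometry.EtaleTheta.SettingModelKrullOpenSubgroups
import Literature.AnabelianGeometry.EtaleTheta.SettingGaloisFacts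
import HarnessLib

/-!
# [EtTh] Def. 5.4 (b) at the single-underline setting pin for `Π/Z_{l·N}`, `Π/Z̈_{l·N}` — HYPOTHESIS-FREE at `modelχ` / `modelχq`;
# and `Π^tp_{Z̈_N}` open normal (proof-only)

Mochizuki, *The étale theta function …*, Publ. RIMS **45** (2009) [EtTh], Def. 5.4 (b) p. 327 (PDF p. 101); §1 pp. 14, 17, 20
[cite: MochizukiEtTh2009, Def 5.4 p.327 (PDF p.101)].  abc-iut cell, layer L2, seat abc-iut-w6-d061 (gen 9), row «DEF54b@SETTING-PIN-ZN
MODELS» (abc-iut-L2-lead gen 9, R1301).  PROOF-ONLY (no def / instance / notation; nothing restated).  BY NAME: this seat's p507583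
(`ThetaSubquotient.card_lDeltaModN_ofSetting_gtpZN/_gtpZddN`) and p506083 (`SettingModel.deltaTheta_le_map_toTheta_dtpYN_modelχ(q)`); the
models' `modelχ(q)_isEtThOrigin`, `isTempered_piTemp_modelχ(q)`, `exists_thetaSplitting_gtpZN_iff_modelχ(q)`, `modelχ(q)_nonempty_cyclotomeMod`;
root facts `isOpen_GtpYN/ZN`, `GtpYN/ZN_normal`, `isOpen_GJddN`, `GJddN_normal`, `range_aug`.
* `ThetaSetting.isOpen_GtpZddN` / `gtpZddN_normal`, `exists_openNormalSubgroup_eq_gtpZN/_gtpZddN` — the naming device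
  «`V : OpenNormalSubgroup`, `V = Π^tp_{Z_N}` / `Π^tp_{Z̈_N}`» of p507583 is inhabited for EVERY setting;
* **`SettingModel.card_lDeltaModN_ofSetting_gtpZN_modelχ(q)` / `_gtpZddN_modelχ(q)`** — `Nat.card ((l·Δ_Θ)_{Π/V} ⧸ N-th powers) = N`
  at both models, every `l, N ≥ 1`, all inputs (guard, temperedness, origin clause, cyclotome datum, `Ÿ`-input) DISCHARGED there.
HONEST FRAMING: semi-synthetic models witness OUR clauses only; no §5 datum is instantiated; nothing here bears on [IUTchIII] Cor. 3.12;
no side taken; typed ≠ proved.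
-/

noncomputable section

namespace Literature.AnabelianGeometry.EtaleTheta

open CategoryTheory Literature.AlgebraicGeometry.Frobenioids Literature.AnabelianGeometry.SemiGraphs

/-! ### `Π^tp_{Z̈_N}` is open and normal; the naming device is inhabited -/

namespace ThetaSetting

variable {p : ℕ} [Fact p.Prime] (D : ThetaSetting p)

/-- The pull-back `aug⁻¹(G_{J̈_N})` is normal in `Π^tp_X`: `aug(Π^tp_X) = G_K` (`range_aug`) and `G_{J̈_N} ⊴ G_K` (`GJddN_normal`).
[cite: MochizukiEtTh2009, §1 p.17] -/
theorem comap_aug_GJddN_normal (N : ℕ+) : ((D.GJddN N).comap D.aug.toMonoidHom).Normal := by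
  refine ⟨fun h hh g => ?_⟩
  rw [Subgroup.mem_comap] at hh ⊢
  have hgK : D.aug.toMonoidHom g ∈ D.GK := by
    change D.aug.toMonoidHom g ∈ D.K.fixingSubgroup
    rw [← D.range_aug]; exact ⟨g, rfl⟩
  have hhK : D.aug.toMonoidHom h ∈ D.GK := D.GKN_le_GK N (D.GJN_le_GKN N (D.GJddN_le_GJN N hh))
  have key := (D.GJddN_normal N).conj_mem ⟨D.aug.toMonoidHom h, hhK⟩ (Subgroup.mem_subgroupOf.mpr hh)
    ⟨D.aug.toMonoidHom g, hgK⟩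
  rw [Subgroup.mem_subgroupOf] at key
  simpa only [map_mul, map_inv, Subgroup.coe_mul, Subgroup.coe_inv] using key

/-- `Π^tp_{Ÿ_N}` is normal in `Π^tp_X`. [cite: MochizukiEtTh2009, §1 p.17] -/
theorem gtpYddN_normal (N : ℕ+) : (D.GtpYddN N).Normal := by
  haveI := D.GtpYN_normal (2 * N)
  haveI := D.comap_aug_GJddN_normal N
  exact Subgroup.normal_inf_normal _ _

/-- `Π^tp_{Ÿ_N}` is open in `Π^tp_X`. [cite: MochizukiEtTh2009, §1 p.17] -/
theorem isOpen_GtpYddN (N : ℕ+) : IsOpen (D.GtpYddN N : Set D.PiTemp) :=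
  (D.isOpen_GtpYN (2 * N)).inter ((D.isOpen_GJddN N).preimage D.aug.continuous)

/-- `Π^tp_{Z̈_N}` is normal in `Π^tp_X`. [cite: MochizukiEtTh2009, §1 p.17] -/
theorem gtpZddN_normal (N : ℕ+) : (D.GtpZddN N).Normal := by
  haveI := D.gtpYddN_normal N
  haveI := D.GtpZN_normal N
  exact Subgroup.normal_inf_normal _ _

/-- `Π^tp_{Z̈_N}` is open in `Π^tp_X`. [cite: MochizukiEtTh2009, §1 p.17] -/
theorem isOpen_GtpZddN (N : ℕ+) : IsOpen (D.GtpZddN N : Set D.PiTemp) :=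
  (D.isOpen_GtpYddN N).inter (D.isOpen_GtpZN N)

/-- The naming device of the pinned (b): an open normal `V` with `V = Π^tp_{Z_N}` exists for every setting.
[cite: MochizukiEtTh2009, §1 p.14] -/
theorem exists_openNormalSubgroup_eq_gtpZN (N : ℕ+) : ∃ V : OpenNormalSubgroup D.PiTemp, V.toSubgroup = D.GtpZN N :=
  ⟨{ toSubgroup := D.GtpZN N, isOpen' := D.isOpen_GtpZN N, isNormal' := D.GtpZN_normal N }, rfl⟩

/-- … and with `V = Π^tp_{Z̈_N}`. [cite: MochizukiEtTh2009, §1 p.17] -/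
theorem exists_openNormalSubgroup_eq_gtpZddN (N : ℕ+) : ∃ V : OpenNormalSubgroup D.PiTemp, V.toSubgroup = D.GtpZddN N :=
  ⟨{ toSubgroup := D.GtpZddN N, isOpen' := D.isOpen_GtpZddN N, isNormal' := D.gtpZddN_normal N }, rfl⟩

end ThetaSetting

/-! ### The χ-twisted model `modelχ` -/

namespace SettingModel

variable (p : ℕ) [Fact p.Prime] (l N : ℕ+)

/-- **Def. 5.4 (b) at the pin for `Π/Z_{l·N}` at `modelχ`, hypothesis-free.** [cite: MochizukiEtTh2009, Def 5.4 p.327 (PDF p.101)] -/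
theorem card_lDeltaModN_ofSetting_gtpZN_modelχ (V : OpenNormalSubgroup (ThetaSetting.modelχ p).PiTemp)
    (hVZ : V.toSubgroup = (ThetaSetting.modelχ p).GtpZN (l * N)) :
    Nat.card ((ThetaSubquotient.ofSetting (ThetaSetting.modelχ p) l).lDelta
        ⟨BTemp.Q (isTempered_piTemp_modelχ p) V, ThetaSubquotient.isConnectedObj_Q (isTempered_piTemp_modelχ p) V⟩ ⧸
      (powMonoidHom (N : ℕ) : (ThetaSubquotient.ofSetting (ThetaSetting.modelχ p) l).lDelta
          ⟨BTemp.Q (isTempered_piTemp_modelχ p) V, ThetaSubquotient.isConnectedObj_Q (isTempered_piTemp_modelχ p) V⟩ →*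
        (ThetaSubquotient.ofSetting (ThetaSetting.modelχ p) l).lDelta
          ⟨BTemp.Q (isTempered_piTemp_modelχ p) V, ThetaSubquotient.isConnectedObj_Q (isTempered_piTemp_modelχ p) V⟩).range) = N := by
  obtain ⟨μ⟩ := modelχ_nonempty_cyclotomeMod p l.pos N
  obtain ⟨s, hs, hcl⟩ := exists_thetaSplitting_gtpZN_iff_modelχ p (l * N)
  exact ThetaSubquotient.card_lDeltaModN_ofSetting_gtpZN (ThetaSetting.modelχ p) (ThetaSetting.modelχ_isEtThOrigin p)
    (isTempered_piTemp_modelχ p) l N μ hs hcl V hVZ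

/-- **Def. 5.4 (b) at the pin for `Π/Z̈_{l·N}` at `modelχ`, hypothesis-free** (the `Ÿ`-input from p506083's coordinates).
[cite: MochizukiEtTh2009, Def 5.4 p.327 (PDF p.101)] -/
theorem card_lDeltaModN_ofSetting_gtpZddN_modelχ (V : OpenNormalSubgroup (ThetaSetting.modelχ p).PiTemp)
    (hVZ : V.toSubgroup = (ThetaSetting.modelχ p).GtpZddN (l * N)) :
    Nat.card ((ThetaSubquotient.ofSetting (ThetaSetting.modelχ p) l).lDelta
        ⟨BTemp.Q (isTempered_piTemp_modelχ p) V, ThetaSubquotient.isConnectedObj_Q (isTempered_piTemp_modelχ p) V⟩ ⧸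
      (powMonoidHom (N : ℕ) : (ThetaSubquotient.ofSetting (ThetaSetting.modelχ p) l).lDelta
          ⟨BTemp.Q (isTempered_piTemp_modelχ p) V, ThetaSubquotient.isConnectedObj_Q (isTempered_piTemp_modelχ p) V⟩ →*
        (ThetaSubquotient.ofSetting (ThetaSetting.modelχ p) l).lDelta
          ⟨BTemp.Q (isTempered_piTemp_modelχ p) V, ThetaSubquotient.isConnectedObj_Q (isTempered_piTemp_modelχ p) V⟩).range) = N := by
  obtain ⟨μ⟩ := modelχ_nonempty_cyclotomeMod p l.pos N
  obtain ⟨s, hs, hcl⟩ := exists_thetaSplitting_gtpZN_iff_modelχ p (l * N)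
  exact ThetaSubquotient.card_lDeltaModN_ofSetting_gtpZddN (ThetaSetting.modelχ p) (ThetaSetting.modelχ_isEtThOrigin p)
    (isTempered_piTemp_modelχ p) l N μ hs hcl (deltaTheta_le_map_toTheta_dtpYN_modelχ p (2 * (l * N))) V hVZ

/-! ### The stage-2 model `modelχq p i j` (`j` even) -/

section Tate

variable (i j : ℤ) (hj : Even j)

/-- **Def. 5.4 (b) at the pin for `Π/Z_{l·N}` at `modelχq`, hypothesis-free.** [cite: MochizukiEtTh2009, Def 5.4 p.327 (PDF p.101)] -/
theorem card_lDeltaModN_ofSetting_gtpZN_modelχq (V : OpenNormalSubgroup (ThetaSetting.modelχq p i j hj).PiTemp)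
    (hVZ : V.toSubgroup = (ThetaSetting.modelχq p i j hj).GtpZN (l * N)) :
    Nat.card ((ThetaSubquotient.ofSetting (ThetaSetting.modelχq p i j hj) l).lDelta
        ⟨BTemp.Q (isTempered_piTemp_modelχq p i j hj) V,
          ThetaSubquotient.isConnectedObj_Q (isTempered_piTemp_modelχq p i j hj) V⟩ ⧸
      (powMonoidHom (N : ℕ) : (ThetaSubquotient.ofSetting (ThetaSetting.modelχq p i j hj) l).lDelta
          ⟨BTemp.Q (isTempered_piTemp_modelχq p i j hj) V,
            ThetaSubquotient.isConnectedObj_Q (isTempered_piTemp_modelχq p i j hj) V⟩ →*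
        (ThetaSubquotient.ofSetting (ThetaSetting.modelχq p i j hj) l).lDelta
          ⟨BTemp.Q (isTempered_piTemp_modelχq p i j hj) V,
            ThetaSubquotient.isConnectedObj_Q (isTempered_piTemp_modelχq p i j hj) V⟩).range) = N := by
  obtain ⟨μ⟩ := modelχq_nonempty_cyclotomeMod p i j hj l.pos N
  obtain ⟨s, hs, hcl⟩ := exists_thetaSplitting_gtpZN_iff_modelχq p i j hj (l * N)
  exact ThetaSubquotient.card_lDeltaModN_ofSetting_gtpZN (ThetaSetting.modelχq p i j hj)
    (ThetaSetting.modelχq_isEtThOrigin p i j hj) (isTempered_piTemp_modelχq p i j hj) l N μ hs hcl V hVZ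

/-- **Def. 5.4 (b) at the pin for `Π/Z̈_{l·N}` at `modelχq`, hypothesis-free.** [cite: MochizukiEtTh2009, Def 5.4 p.327 (PDF p.101)] -/
theorem card_lDeltaModN_ofSetting_gtpZddN_modelχq (V : OpenNormalSubgroup (ThetaSetting.modelχq p i j hj).PiTemp)
    (hVZ : V.toSubgroup = (ThetaSetting.modelχq p i j hj).GtpZddN (l * N)) :
    Nat.card ((ThetaSubquotient.ofSetting (ThetaSetting.modelχq p i j hj) l).lDelta
        ⟨BTemp.Q (isTempered_piTemp_modelχq p i j hj) V,
          ThetaSubquotient.isConnectedObj_Q (isTempered_piTemp_modelχq p i j hj) V⟩ ⧸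
      (powMonoidHom (N : ℕ) : (ThetaSubquotient.ofSetting (ThetaSetting.modelχq p i j hj) l).lDelta
          ⟨BTemp.Q (isTempered_piTemp_modelχq p i j hj) V,
            ThetaSubquotient.isConnectedObj_Q (isTempered_piTemp_modelχq p i j hj) V⟩ →*
        (ThetaSubquotient.ofSetting (ThetaSetting.modelχq p i j hj) l).lDelta
          ⟨BTemp.Q (isTempered_piTemp_modelχq p i j hj) V,
            ThetaSubquotient.isConnectedObj_Q (isTempered_piTemp_modelχq p i j hj) V⟩).range) = N := by
  obtain ⟨μ⟩ := modelχq_nonempty_cyclotomeMod p i j hj l.pos N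
  obtain ⟨s, hs, hcl⟩ := exists_thetaSplitting_gtpZN_iff_modelχq p i j hj (l * N)
  exact ThetaSubquotient.card_lDeltaModN_ofSetting_gtpZddN (ThetaSetting.modelχq p i j hj)
    (ThetaSetting.modelχq_isEtThOrigin p i j hj) (isTempered_piTemp_modelχq p i j hj) l N μ hs hcl
    (deltaTheta_le_map_toTheta_dtpYN_modelχq p i j hj (2 * (l * N))) V hVZ

end Tate

end SettingModel

end Literature.AnabelianGeometry.EtaleTheta

end
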